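import Mathlib
import HarnessLib
import Literature.Analysis.FluidPDE.SelfSimilar
import Literature.Analysis.FluidPDE.TypeIAncientMild
import Summits.NavierStokesRegularity.NavierStokesRegularity.Theorems.QuarterLogPincerTypeIQuantSubcubicExpFrameTools
import Summits.NavierStokesRegularity.NavierStokesRegularity.Theorems.PoloidalWindowDoorPoloidalWindowRigidityClassSpaceTimeRates

/-!
# Route `QuarterLogPincer`, crux `TypeIQuantSubcubicExp` (stmt-NavierStokesRegularity-24077), line `quiet_collar` —
  SPIKE-COUNTING TOOLS for QP1 (the quiet collar): slab Lipschitz bounds of the Type-I mild class, the box of cube mass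
  below a spike, radial Chebyshev–Fubini averaging, and the time-integrated slab budget

Groundwork for the by-name landing of QP1 `stub_quietCollar : StubQuietCollar` of ns-idea-7 g9's line `quiet_collar`
v1.1 (`Cruxes/TypeIQuantSubcubicExp/Lines/quiet_collar.lean`, tree sha16 `8170489f8bcaaff9`; critic of record idea-crit-4
g6; DIRECTOR-NS dss_121 key (B) to the pub-ns-dss typer g36), in `Theorems/QuarterLogPincerQuietCollarLever.lean`.  The
road is the line docstring's SPIKE COUNTING, with Chebyshev–Fubini over the radius in place of Vitali:

* §1 `exists_slab_lipschitz` — for `v` in the Type-I ancient mild class ONE constant `D₀ ≥ 1` such that on every slab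
  `s ∈ [−1,−ε/2]` the slices are `D₀/ε²`-Lipschitz in space and the time lines `D₀/ε²`-Lipschitz in time: the tree
  CLASS RATES `‖∇v(s)‖ ≤ K_x/(−s)` (`…ClassSpaceTimeRates.exists_fderiv_rate_of_class'`) and
  `‖∂ₛv(s)‖ ≤ K_t/((−s)√(−s))` (`…exists_deriv_rate_of_class`, KNSS 2009 Prop. 4.1 restarted), fed by the Oseen identity
  `IsTypeIAncientMild.mild_eq_heatExtension`, plus the mean value inequality.  (This discharges the one risk the line
  card flags for QP1: the time-derivative bound for MILD ancient fields is available in the tree's frame.)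
* §2 `le_boxIntegral_of_spike` — under those Lipschitz bounds a spike `‖v(s₀,x₀)‖ > η`, `s₀ ∈ [−1,−ε]`, forces
  `‖v‖ ≥ η/2` on the forward box `[s₀, s₀+a] × B̄(x₀,a)`, `a = η/(4D)`, whose cube mass is `≥ (η/2)³·a·a³·|B₁|`.
* §3 `exists_radius_shellMass_le` — pure measure theory: for a measurable density `G` on `ℝ × ℝ³` and times `I`, some
  radius `r ∈ [ρ,2ρ]` has thickened-shell mass `∫_{I×{r−a ≤ |x| ≤ r+L+a}} G ≤ ((L+2a)/ρ)·∫_{I×B(0,2ρ+L+a+1)} G` (Tonelli: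
  each point lies in the thickened shell of a set of radii of length `≤ L+2a`; the minimum is below the mean).
* §4 `slabMass_le_of_slices` — `L³` bounds `≤ b` on the `B(0,R)`-localised slices over `[−1,−ε/2]` give cube mass
  `≤ b³` on `[−1,−ε/2] × B(0,R)` (Tonelli, interval length `≤ 1`).

HONEST FRAMING: elementary real analysis about HYPOTHETICAL Type-I ancient mild fields and an abstract averaging lemma;
nothing here bears on 24077, the DSS wall W7 or Navier–Stokes regularity, all OPEN / not proved.
-/

noncomputable section

-- the summit-side namespace repeats a component by design (D-0017)
set_option linter.dupNamespace false

namespace Summit.NavierStokesRegularity.NavierStokesRegularity.Cruxes.TypeIQuantSubcubicExp.QuietCollar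

open MeasureTheory Set Function Metric Filter Topology
open scoped ENNReal NNReal
open Literature.Analysis Literature.Analysis.FluidPDE
open Summit.NavierStokesRegularity.NavierStokesRegularity.Theorems.PoloidalWindowDoorPoloidalWindowRigidityClassSpaceTimeRates
  (exists_fderiv_rate_of_class' exists_deriv_rate_of_class)
open Summit.NavierStokesRegularity.NavierStokesRegularity.Theorems.ThinCascade (lintegral_cube_le_of_eLpNorm_three_le)

/-! ### 1. Slab Lipschitz bounds from the class rates -/

/-- **Lipschitz bounds on the slabs `[−1,−ε/2] × ℝ³`.**  For a Type-I ancient mild field there is ONE `D₀ ≥ 1`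
such that on every slab `s ∈ [−1, −ε/2]` (`0 < ε ≤ 1`) the slices are `D₀/ε²`-Lipschitz in space and the time
lines are `D₀/ε²`-Lipschitz in time — from the tree CLASS RATES `‖∇v(s)‖ ≤ K_x/(−s)`
(`exists_fderiv_rate_of_class'`) and `‖∂ₛv(s)‖ ≤ K_t/((−s)√(−s))` (`exists_deriv_rate_of_class`), fed by the
Oseen identity `IsTypeIAncientMild.mild_eq_heatExtension`, and the mean value inequality. -/
theorem exists_slab_lipschitz {M : ℝ} {v : ℝ → EuclideanSpace ℝ (Fin 3) → EuclideanSpace ℝ (Fin 3)}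
    (hv : IsTypeIAncientMild M v) :
    ∃ D₀ : ℝ, 1 ≤ D₀ ∧ ∀ ε : ℝ, 0 < ε → ε ≤ 1 →
      (∀ s ∈ Set.Icc (-1 : ℝ) (-(ε / 2)), ∀ x y : EuclideanSpace ℝ (Fin 3),
          ‖v s x - v s y‖ ≤ D₀ / ε ^ 2 * ‖x - y‖) ∧
      (∀ x : EuclideanSpace ℝ (Fin 3), ∀ s ∈ Set.Icc (-1 : ℝ) (-(ε / 2)), ∀ s' ∈ Set.Icc (-1 : ℝ) (-(ε / 2)),
          ‖v s x - v s' x‖ ≤ D₀ / ε ^ 2 * |s - s'|) := by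
  have hcont : ContinuousOn (uncurry v) (Iio (0 : ℝ) ×ˢ univ) := hv.1.continuousOn
  have hmild : ∀ s t : ℝ, s < t → t < 0 → ∀ y,
      v t y = UnboundedOperators.heatExtension (v s) (t - s) y - oseenDuhamel 1 s v v t y :=
    fun s t hst ht y => hv.mild_eq_heatExtension hst ht y
  obtain ⟨Kx, hKx0, hKx⟩ := exists_fderiv_rate_of_class' hv.2.2.2 hcont hmild
  obtain ⟨Kt, hKt0, hKt⟩ := exists_deriv_rate_of_class hv.2.2.2 hcont hmild
  -- differentiability of slices and time lines on the open past
  have hdiff : DifferentiableOn ℝ (uncurry v) (Iio (0 : ℝ) ×ˢ univ) := hv.1.differentiableOn (by simp)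
  have hopen : IsOpen (Iio (0 : ℝ) ×ˢ (univ : Set (EuclideanSpace ℝ (Fin 3)))) :=
    isOpen_Iio.prod isOpen_univ
  have hdAt : ∀ s < (0 : ℝ), ∀ x : EuclideanSpace ℝ (Fin 3), DifferentiableAt ℝ (uncurry v) (s, x) :=
    fun s hs x => hdiff.differentiableAt (hopen.mem_nhds ⟨hs, mem_univ _⟩)
  have hslice : ∀ s < (0 : ℝ), ∀ x : EuclideanSpace ℝ (Fin 3), DifferentiableAt ℝ (v s) x := by
    intro s hs x
    have h2 : DifferentiableAt ℝ (fun y : EuclideanSpace ℝ (Fin 3) => ((s, y) : ℝ × EuclideanSpace ℝ (Fin 3))) x :=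
      (differentiableAt_const s).prodMk differentiableAt_id
    exact (hdAt s hs x).comp x h2
  have hline : ∀ x : EuclideanSpace ℝ (Fin 3), ∀ s < (0 : ℝ), DifferentiableAt ℝ (fun τ => v τ x) s := by
    intro x s hs
    have h2 : DifferentiableAt ℝ (fun τ : ℝ => ((τ, x) : ℝ × EuclideanSpace ℝ (Fin 3))) s :=
      differentiableAt_id.prodMk (differentiableAt_const x)
    exact (hdAt s hs x).comp s h2
  refine ⟨2 * Kx + 4 * Kt + 1, by linarith, fun ε hε hε1 => ⟨?_, ?_⟩⟩
  · intro s hs x y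
    have hs0 : s < 0 := by linarith [hs.2]
    have hns : ε / 2 ≤ -s := by linarith [hs.2]
    -- `‖∇v(s)‖ ≤ Kx/(−s) ≤ 2Kx/ε ≤ D₀/ε²`
    have hbound : ∀ z ∈ (univ : Set (EuclideanSpace ℝ (Fin 3))), ‖fderiv ℝ (v s) z‖ ≤ (2 * Kx + 4 * Kt + 1) / ε ^ 2 := by
      intro z _
      refine (hKx s hs0 z).trans ?_
      rw [div_le_div_iff₀ (by linarith) (by positivity)]
      have h1 : Kx * ε ^ 2 ≤ Kx * ε := mul_le_mul_of_nonneg_left (by nlinarith) hKx0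
      have h2 : Kx * ε ≤ 2 * Kx * (-s) := by nlinarith
      have h3 : 2 * Kx * (-s) ≤ (2 * Kx + 4 * Kt + 1) * (-s) :=
        mul_le_mul_of_nonneg_right (by linarith) (by linarith)
      linarith
    have := Convex.norm_image_sub_le_of_norm_fderiv_le (fun z _ => hslice s hs0 z) hbound convex_univ
      (mem_univ y) (mem_univ x)
    simpa using this
  · intro x s hs s' hs'
    have hbound : ∀ τ ∈ Set.Icc (-1 : ℝ) (-(ε / 2)), ‖deriv (fun τ => v τ x) τ‖ ≤ (2 * Kx + 4 * Kt + 1) / ε ^ 2 := by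
      intro τ hτ
      have hτ0 : τ < 0 := by linarith [hτ.2]
      have hnτ : ε / 2 ≤ -τ := by linarith [hτ.2]
      have hnτ1 : -τ ≤ 1 := by linarith [hτ.1]
      refine (hKt τ hτ0 x).trans ?_
      -- `(−τ)√(−τ) ≥ (−τ)² ≥ ε²/4`
      have hsq : -τ ≤ Real.sqrt (-τ) := by
        rw [Real.le_sqrt (by linarith) (by linarith)]
        nlinarith
      have hden : ε ^ 2 / 4 ≤ (-τ) * Real.sqrt (-τ) := by
        have : (-τ) * (-τ) ≤ (-τ) * Real.sqrt (-τ) := mul_le_mul_of_nonneg_left hsq (by linarith)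
        nlinarith
      have hpos : 0 < (-τ) * Real.sqrt (-τ) := lt_of_lt_of_le (by positivity) hden
      rw [div_le_div_iff₀ hpos (by positivity)]
      calc Kt * ε ^ 2 = 4 * Kt * (ε ^ 2 / 4) := by ring
        _ ≤ 4 * Kt * ((-τ) * Real.sqrt (-τ)) := mul_le_mul_of_nonneg_left hden (by positivity)
        _ ≤ (2 * Kx + 4 * Kt + 1) * ((-τ) * Real.sqrt (-τ)) :=
          mul_le_mul_of_nonneg_right (by linarith) hpos.le
    have := Convex.norm_image_sub_le_of_norm_deriv_le (fun τ hτ => hline x τ (by linarith [hτ.2])) hbound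
      (convex_Icc _ _) hs' hs
    rw [Real.norm_eq_abs] at this
    exact this

/-! ### 2. The box below a spike -/

/-- **A spike carries a box of cube mass.**  If the slices are `D`-Lipschitz in space and the time lines
`D`-Lipschitz in time on the slab `[−1,−ε/2]`, and `‖v(s₀,x₀)‖ > η` at some `s₀ ∈ [−1,−ε]`, then with
`a = η/(4D) ≤ ε/2` one has `‖v‖ ≥ η/2` on the forward box `[s₀, s₀+a] × B̄(x₀, a)`, whose cube mass is therefore
at least `(η/2)³ · a · a³ · |B₁|`. -/
theorem le_boxIntegral_of_spike {v : ℝ → EuclideanSpace ℝ (Fin 3) → EuclideanSpace ℝ (Fin 3)}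
    {ε η D a s₀ : ℝ} {x₀ : EuclideanSpace ℝ (Fin 3)} (hD : 0 < D) (hη : 0 < η)
    (ha : a = η / (4 * D)) (haε : a ≤ ε / 2)
    (hLx : ∀ s ∈ Set.Icc (-1 : ℝ) (-(ε / 2)), ∀ x y : EuclideanSpace ℝ (Fin 3),
      ‖v s x - v s y‖ ≤ D * ‖x - y‖)
    (hLt : ∀ x : EuclideanSpace ℝ (Fin 3), ∀ s ∈ Set.Icc (-1 : ℝ) (-(ε / 2)),
      ∀ s' ∈ Set.Icc (-1 : ℝ) (-(ε / 2)), ‖v s x - v s' x‖ ≤ D * |s - s'|)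
    (hs₀ : s₀ ∈ Set.Icc (-1 : ℝ) (-ε)) (hspike : η < ‖v s₀ x₀‖) :
    ENNReal.ofReal ((η / 2) ^ 3 * (a * (a ^ 3 *
        volume.real (Metric.ball (0 : EuclideanSpace ℝ (Fin 3)) 1)))) ≤
      ∫⁻ p in Set.Icc s₀ (s₀ + a) ×ˢ Metric.closedBall x₀ a, ENNReal.ofReal (‖v p.1 p.2‖ ^ 3) := by
  have ha0 : 0 < a := by rw [ha]; positivity
  have hε : 0 < ε := by linarith
  -- pointwise lower bound on the box
  have hpt : ∀ p ∈ Set.Icc s₀ (s₀ + a) ×ˢ Metric.closedBall x₀ a,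
      ENNReal.ofReal ((η / 2) ^ 3) ≤ ENNReal.ofReal (‖v p.1 p.2‖ ^ 3) := by
    rintro ⟨s, x⟩ hp
    obtain ⟨hs, hx⟩ := mem_prod.1 hp
    rw [mem_closedBall, dist_eq_norm] at hx
    have hsI : s ∈ Set.Icc (-1 : ℝ) (-(ε / 2)) := ⟨by linarith [hs.1, hs₀.1], by linarith [hs.2, hs₀.2]⟩
    have hs₀I : s₀ ∈ Set.Icc (-1 : ℝ) (-(ε / 2)) := ⟨hs₀.1, by linarith [hs₀.2]⟩
    have h1 : ‖v s x - v s x₀‖ ≤ D * a := (hLx s hsI x x₀).trans (mul_le_mul_of_nonneg_left hx hD.le)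
    have h2 : ‖v s x₀ - v s₀ x₀‖ ≤ D * a := by
      refine (hLt x₀ s hsI s₀ hs₀I).trans (mul_le_mul_of_nonneg_left ?_ hD.le)
      rw [abs_le]; constructor <;> linarith [hs.1, hs.2]
    have h3 : ‖v s x - v s₀ x₀‖ ≤ η / 2 := by
      calc ‖v s x - v s₀ x₀‖ = ‖(v s x - v s x₀) + (v s x₀ - v s₀ x₀)‖ := by congr 1; abel
        _ ≤ ‖v s x - v s x₀‖ + ‖v s x₀ - v s₀ x₀‖ := norm_add_le _ _
        _ ≤ D * a + D * a := add_le_add h1 h2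
        _ = η / 2 := by rw [ha]; field_simp; ring
    have h4 : η / 2 ≤ ‖v s x‖ := by
      have := norm_sub_norm_le (v s₀ x₀) (v s x)
      rw [norm_sub_rev] at this
      linarith
    exact ENNReal.ofReal_le_ofReal (pow_le_pow_left₀ (by positivity) h4 3)
  have hmeas : MeasurableSet (Set.Icc s₀ (s₀ + a) ×ˢ Metric.closedBall x₀ a) :=
    measurableSet_Icc.prod measurableSet_closedBall
  calc ENNReal.ofReal ((η / 2) ^ 3 * (a * (a ^ 3 *
          volume.real (Metric.ball (0 : EuclideanSpace ℝ (Fin 3)) 1))))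
      = ENNReal.ofReal ((η / 2) ^ 3) *
          volume (Set.Icc s₀ (s₀ + a) ×ˢ Metric.closedBall x₀ a) := by
        rw [Measure.volume_eq_prod, Measure.prod_prod, Real.volume_Icc,
          Measure.addHaar_closedBall _ _ ha0.le, finrank_euclideanSpace_fin,
          show s₀ + a - s₀ = a by ring, Measure.real,
          ENNReal.ofReal_mul (by positivity), ENNReal.ofReal_mul ha0.le, ENNReal.ofReal_mul (by positivity),
          ENNReal.ofReal_toReal (measure_ball_lt_top).ne]
    _ = ∫⁻ p in Set.Icc s₀ (s₀ + a) ×ˢ Metric.closedBall x₀ a, ENNReal.ofReal ((η / 2) ^ 3) := by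
        rw [setLIntegral_const]
    _ ≤ ∫⁻ p in Set.Icc s₀ (s₀ + a) ×ˢ Metric.closedBall x₀ a, ENNReal.ofReal (‖v p.1 p.2‖ ^ 3) :=
        setLIntegral_mono' hmeas hpt


/-! ### 3. Radial Chebyshev–Fubini averaging -/

/-- **Radial averaging (Chebyshev–Fubini).**  For a measurable density `G` on `ℝ × ℝ³`, a measurable set of
times `I`, a base radius `ρ > 0`, a width `L ≥ 0` and a margin `a ≥ 0`: if the `G`-mass of `I × B(0, 2ρ+L+a+1)` is
at most `Λ`, then some radius `r ∈ [ρ, 2ρ]` has thickened-shell mass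
`∫_{I × {r−a ≤ |x| ≤ r+L+a}} G ≤ ((L+2a)/ρ)·Λ` — because `∫_ρ^{2ρ} (that mass) dr ≤ (L+2a)·Λ` by Tonelli (every point
`x` lies in the thickened shell of a set of radii of length `≤ L+2a`), and the minimum is below the mean. -/
theorem exists_radius_shellMass_le
    {G : ℝ × EuclideanSpace ℝ (Fin 3) → ℝ≥0∞} (hG : Measurable G) {I : Set ℝ} (hI : MeasurableSet I)
    {ρ L a : ℝ} (hρ : 0 < ρ) {Λ : ℝ≥0∞}
    (hbud : ∫⁻ p in I ×ˢ Metric.ball (0 : EuclideanSpace ℝ (Fin 3)) (2 * ρ + L + a + 1), G p ≤ Λ) :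
    ∃ r ∈ Set.Icc ρ (2 * ρ),
      ∫⁻ p in I ×ˢ {x : EuclideanSpace ℝ (Fin 3) | r - a ≤ ‖x‖ ∧ ‖x‖ ≤ r + L + a}, G p ≤
        ENNReal.ofReal ((L + 2 * a) / ρ) * Λ := by
  -- the joint integrand `F (r, p) = 1[p.1 ∈ I, r − a ≤ ‖p.2‖ ≤ r + L + a] · G p`
  set S : Set (ℝ × (ℝ × EuclideanSpace ℝ (Fin 3))) :=
    {q | q.2.1 ∈ I ∧ (q.1 - a ≤ ‖q.2.2‖ ∧ ‖q.2.2‖ ≤ q.1 + L + a)} with hS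
  have hn : Measurable fun q : ℝ × (ℝ × EuclideanSpace ℝ (Fin 3)) => ‖q.2.2‖ :=
    (measurable_snd.comp measurable_snd).norm
  have hSm : MeasurableSet S := by
    have h1 : MeasurableSet {q : ℝ × (ℝ × EuclideanSpace ℝ (Fin 3)) | q.2.1 ∈ I} :=
      (measurable_fst.comp measurable_snd) hI
    have h2 : MeasurableSet {q : ℝ × (ℝ × EuclideanSpace ℝ (Fin 3)) | q.1 - a ≤ ‖q.2.2‖} :=
      measurableSet_le (measurable_fst.sub measurable_const) hn
    have h3 : MeasurableSet {q : ℝ × (ℝ × EuclideanSpace ℝ (Fin 3)) | ‖q.2.2‖ ≤ q.1 + L + a} :=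
      measurableSet_le hn ((measurable_fst.add measurable_const).add measurable_const)
    have : S = {q | q.2.1 ∈ I} ∩ ({q | q.1 - a ≤ ‖q.2.2‖} ∩ {q | ‖q.2.2‖ ≤ q.1 + L + a}) := by
      ext q; simp [hS]
    rw [this]
    exact h1.inter (h2.inter h3)
  set F : ℝ × (ℝ × EuclideanSpace ℝ (Fin 3)) → ℝ≥0∞ := S.indicator (fun q => G q.2) with hF
  have hFm : Measurable F := (hG.comp measurable_snd).indicator hSm
  -- the shell mass at radius `r` is `∫ F (r, ·)`
  have hshell : ∀ r : ℝ, MeasurableSet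
      (I ×ˢ {x : EuclideanSpace ℝ (Fin 3) | r - a ≤ ‖x‖ ∧ ‖x‖ ≤ r + L + a}) := by
    intro r
    refine hI.prod ?_
    have hn' : Measurable fun x : EuclideanSpace ℝ (Fin 3) => ‖x‖ := measurable_norm
    have : {x : EuclideanSpace ℝ (Fin 3) | r - a ≤ ‖x‖ ∧ ‖x‖ ≤ r + L + a} =
        {x | r - a ≤ ‖x‖} ∩ {x | ‖x‖ ≤ r + L + a} := by ext x; simp
    rw [this]
    exact (measurableSet_le measurable_const hn').inter (measurableSet_le hn' measurable_const)
  have hΦ : ∀ r : ℝ,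
      ∫⁻ p in I ×ˢ {x : EuclideanSpace ℝ (Fin 3) | r - a ≤ ‖x‖ ∧ ‖x‖ ≤ r + L + a}, G p =
        ∫⁻ p, F (r, p) := by
    intro r
    rw [← lintegral_indicator (hshell r)]
    refine lintegral_congr fun p => ?_
    by_cases hp : p ∈ I ×ˢ {x : EuclideanSpace ℝ (Fin 3) | r - a ≤ ‖x‖ ∧ ‖x‖ ≤ r + L + a}
    · have hq : (r, p) ∈ S := by
        obtain ⟨h1, h2⟩ := mem_prod.1 hp
        exact ⟨h1, h2⟩
      rw [Set.indicator_of_mem hp, hF, Set.indicator_of_mem hq]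
    · have hq : (r, p) ∉ S := fun h => hp (mem_prod.2 ⟨h.1, h.2⟩)
      rw [Set.indicator_of_notMem hp, hF, Set.indicator_of_notMem hq]
  -- Tonelli and the pointwise bound on the inner `r`-integral
  set R : ℝ := 2 * ρ + L + a + 1 with hR
  have hinner : ∀ p : ℝ × EuclideanSpace ℝ (Fin 3),
      ∫⁻ r in Set.Icc ρ (2 * ρ), F (r, p) ≤
        ENNReal.ofReal (L + 2 * a) * (I ×ˢ Metric.ball (0 : EuclideanSpace ℝ (Fin 3)) R).indicator G p := by
    rintro ⟨s, x⟩
    -- `F (r, (s,x)) ≤ 1_{[‖x‖−L−a, ‖x‖+a]}(r) · 1_{I × B_R}(s,x) · G (s,x)` for `r ∈ [ρ, 2ρ]`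
    have hpt : ∀ r ∈ Set.Icc ρ (2 * ρ), F (r, (s, x)) ≤
        (Set.Icc (‖x‖ - L - a) (‖x‖ + a)).indicator
          (fun _ => (I ×ˢ Metric.ball (0 : EuclideanSpace ℝ (Fin 3)) R).indicator G (s, x)) r := by
      intro r hr
      by_cases hq : (r, (s, x)) ∈ S
      · obtain ⟨hsI, h1, h2⟩ := id hq
        have hrI : r ∈ Set.Icc (‖x‖ - L - a) (‖x‖ + a) := ⟨by linarith, by linarith⟩
        have hxB : (s, x) ∈ I ×ˢ Metric.ball (0 : EuclideanSpace ℝ (Fin 3)) R := by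
          refine mem_prod.2 ⟨hsI, ?_⟩
          rw [mem_ball, dist_zero_right]
          linarith [hr.2]
        rw [hF, Set.indicator_of_mem hq, Set.indicator_of_mem hrI, Set.indicator_of_mem hxB]
      · rw [hF, Set.indicator_of_notMem hq]
        exact bot_le
    calc ∫⁻ r in Set.Icc ρ (2 * ρ), F (r, (s, x))
        ≤ ∫⁻ r in Set.Icc ρ (2 * ρ), (Set.Icc (‖x‖ - L - a) (‖x‖ + a)).indicator
            (fun _ => (I ×ˢ Metric.ball (0 : EuclideanSpace ℝ (Fin 3)) R).indicator G (s, x)) r :=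
          setLIntegral_mono' measurableSet_Icc hpt
      _ ≤ ∫⁻ r, (Set.Icc (‖x‖ - L - a) (‖x‖ + a)).indicator
            (fun _ => (I ×ˢ Metric.ball (0 : EuclideanSpace ℝ (Fin 3)) R).indicator G (s, x)) r :=
          setLIntegral_le_lintegral _ _
      _ = (I ×ˢ Metric.ball (0 : EuclideanSpace ℝ (Fin 3)) R).indicator G (s, x) *
            volume (Set.Icc (‖x‖ - L - a) (‖x‖ + a)) := lintegral_indicator_const measurableSet_Icc _
      _ = ENNReal.ofReal (L + 2 * a) *
            (I ×ˢ Metric.ball (0 : EuclideanSpace ℝ (Fin 3)) R).indicator G (s, x) := by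
          rw [Real.volume_Icc, show ‖x‖ + a - (‖x‖ - L - a) = L + 2 * a by ring, mul_comm]
  have htot : ∫⁻ r in Set.Icc ρ (2 * ρ), ∫⁻ p, F (r, p) ≤ ENNReal.ofReal (L + 2 * a) * Λ := by
    calc ∫⁻ r in Set.Icc ρ (2 * ρ), ∫⁻ p, F (r, p)
        = ∫⁻ p, ∫⁻ r in Set.Icc ρ (2 * ρ), F (r, p) :=
          lintegral_lintegral_swap (hFm.comp measurable_id).aemeasurable
      _ ≤ ∫⁻ p, ENNReal.ofReal (L + 2 * a) *
            (I ×ˢ Metric.ball (0 : EuclideanSpace ℝ (Fin 3)) R).indicator G p := lintegral_mono hinner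
      _ = ENNReal.ofReal (L + 2 * a) *
            ∫⁻ p in I ×ˢ Metric.ball (0 : EuclideanSpace ℝ (Fin 3)) R, G p := by
          rw [lintegral_const_mul' _ _ ENNReal.ofReal_ne_top,
            lintegral_indicator (hI.prod measurableSet_ball)]
      _ ≤ ENNReal.ofReal (L + 2 * a) * Λ := by gcongr
  -- the minimum is below the mean
  have hvol : volume (Set.Icc ρ (2 * ρ)) = ENNReal.ofReal ρ := by
    rw [Real.volume_Icc, show 2 * ρ - ρ = ρ by ring]
  have hne : volume (Set.Icc ρ (2 * ρ)) ≠ 0 := by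
    rw [hvol]; exact (ENNReal.ofReal_pos.2 hρ).ne'
  have hnt : volume (Set.Icc ρ (2 * ρ)) ≠ ∞ := by rw [hvol]; exact ENNReal.ofReal_ne_top
  have hΦm : Measurable fun r : ℝ => ∫⁻ p, F (r, p) := hFm.lintegral_prod_right'
  obtain ⟨r, hr, hle⟩ := exists_le_setLAverage hne hnt hΦm.aemeasurable
  refine ⟨r, hr, ?_⟩
  rw [hΦ r]
  refine hle.trans ?_
  rw [setLAverage_eq, hvol, ENNReal.div_eq_inv_mul]
  calc (ENNReal.ofReal ρ)⁻¹ * ∫⁻ r in Set.Icc ρ (2 * ρ), ∫⁻ p, F (r, p)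
      ≤ (ENNReal.ofReal ρ)⁻¹ * (ENNReal.ofReal (L + 2 * a) * Λ) := by gcongr
    _ = ENNReal.ofReal ((L + 2 * a) / ρ) * Λ := by
        rw [← mul_assoc, ENNReal.ofReal_div_of_pos hρ, ENNReal.div_eq_inv_mul]

/-! ### 4. The time-integrated budget on a slab -/

/-- **Slab budget.**  If the `B(0,R)`-localised slices `v(s)`, `s ∈ [−1,−ε/2]`, are bounded by `b ≥ 0` in `L³`,
then the cube mass of `[−1,−ε/2] × B(0,R)` is at most `b³` (Tonelli; the time interval has length `≤ 1`). -/
theorem slabMass_le_of_slices {v : ℝ → EuclideanSpace ℝ (Fin 3) → EuclideanSpace ℝ (Fin 3)}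
    (hcont : ContinuousOn (uncurry v) (Iio (0 : ℝ) ×ˢ univ)) {ε R b : ℝ} (hε : 0 < ε) (hb : 0 ≤ b)
    (hsl : ∀ s ∈ Set.Icc (-1 : ℝ) (-(ε / 2)),
      eLpNorm ((Metric.ball (0 : EuclideanSpace ℝ (Fin 3)) R).indicator (v s)) 3 volume ≤
        ENNReal.ofReal b) :
    ∫⁻ p in Set.Icc (-1 : ℝ) (-(ε / 2)) ×ˢ Metric.ball (0 : EuclideanSpace ℝ (Fin 3)) R,
        ENNReal.ofReal (‖v p.1 p.2‖ ^ 3) ≤ ENNReal.ofReal (b ^ 3) := by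
  set I : Set ℝ := Set.Icc (-1 : ℝ) (-(ε / 2)) with hIdef
  have hI : MeasurableSet I := measurableSet_Icc
  -- the integrand is continuous on the (measurable) product set, hence a.e.-measurable there
  have hsub : I ×ˢ Metric.ball (0 : EuclideanSpace ℝ (Fin 3)) R ⊆ Iio (0 : ℝ) ×ˢ univ :=
    prod_mono (fun s hs => by simp only [mem_Iio]; linarith [hs.2]) (subset_univ _)
  have hgc : ContinuousOn (fun p : ℝ × EuclideanSpace ℝ (Fin 3) => ENNReal.ofReal (‖v p.1 p.2‖ ^ 3))
      (I ×ˢ Metric.ball (0 : EuclideanSpace ℝ (Fin 3)) R) :=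
    ENNReal.continuous_ofReal.comp_continuousOn (((hcont.mono hsub).norm).pow 3)
  have hga : AEMeasurable (fun p : ℝ × EuclideanSpace ℝ (Fin 3) => ENNReal.ofReal (‖v p.1 p.2‖ ^ 3))
      ((volume.restrict I).prod (volume.restrict (Metric.ball (0 : EuclideanSpace ℝ (Fin 3)) R))) := by
    have := hgc.aemeasurable (hI.prod measurableSet_ball) (μ := volume)
    rwa [Measure.volume_eq_prod, ← Measure.prod_restrict] at this
  rw [Measure.volume_eq_prod, ← Measure.prod_restrict, lintegral_prod _ hga]
  -- slice by slice
  have hslice : ∀ s ∈ I, ∫⁻ x in Metric.ball (0 : EuclideanSpace ℝ (Fin 3)) R,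
      ENNReal.ofReal (‖v s x‖ ^ 3) ≤ ENNReal.ofReal (b ^ 3) := by
    intro s hs
    have h := lintegral_cube_le_of_eLpNorm_three_le (hsl s hs) hb
    rw [← lintegral_indicator measurableSet_ball]
    refine le_of_eq_of_le (lintegral_congr fun x => ?_) h
    by_cases hx : x ∈ Metric.ball (0 : EuclideanSpace ℝ (Fin 3)) R
    · simp [Set.indicator_of_mem hx]
    · simp [Set.indicator_of_notMem hx]
  calc ∫⁻ s in I, ∫⁻ x in Metric.ball (0 : EuclideanSpace ℝ (Fin 3)) R, ENNReal.ofReal (‖v s x‖ ^ 3)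
      ≤ ∫⁻ s in I, ENNReal.ofReal (b ^ 3) := setLIntegral_mono' hI fun s hs => hslice s hs
    _ = ENNReal.ofReal (b ^ 3) * volume I := setLIntegral_const _ _
    _ ≤ ENNReal.ofReal (b ^ 3) * 1 := by
        gcongr
        rw [hIdef, Real.volume_Icc]
        exact ENNReal.ofReal_le_one.2 (by linarith)
    _ = ENNReal.ofReal (b ^ 3) := mul_one _

end Summit.NavierStokesRegularity.NavierStokesRegularity.Cruxes.TypeIQuantSubcubicExp.QuietCollar

end
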